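import Summits.Ventures.LatticeQCDFlow.Exactness.FlowSamplerGroupSymmetrisationDirichlet
import HarnessLib

/-!
# AVERAGING A FLOW OVER A FINITE SYMMETRY GROUP NEVER INCREASES `τ_int` OF ANY OBSERVABLE IN A SYMMETRY SECTOR (invariant observables, sign characters)

HONEST FRAMING: exact (Metropolis-corrected) sampling algorithms for lattice gauge theory;
figures of merit are autocorrelation/cost numbers at stated couplings and volumes; no
continuum-physics claim.  (SCALAR calibration rung S0-A: not a gauge result.)

Venture `LatticeQCDFlow` (cell pub-lqcd), topic `Exactness`; FANOUT row 2 (`s0-phi4`, FLOW arm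
`K_q̃ = imhOp μ w q̃`; group-averaged arm `K_q̄`, `q̄ = N⁻¹ Σ_a q̃ ∘ t_a` for a finite GROUP `G` acting by
measure-preserving symmetries `t_a` of the target weight, `t_{ab} = t_a ∘ t_b`).  NEW WORK of the cell,
the sequel of `FlowSamplerGroupSymmetrisationDirichlet`: the `τ_int` comparison on every SYMMETRY
SECTOR `{u : u ∘ t_a = χ(a)·u}` of a real sign character `χ` (`χ(ab) = χ(a)χ(b)`, `χ(a)² = 1`) — the
trivial character gives the INVARIANT observables (on the lattice: the energy, `M²`, `Σφ²`, every
translation-average under the translation group; the magnetisation under site symmetries), the flip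
sign character gives the magnetisation under the flip-extended group, the alternating character of an
even cycle gives staggered observables.  Assembled, exactly as the `Z₂` file
`FlowSamplerSymmetrisationDirichlet` (§6), from the tree's FORMAT-level variational calculus
(`RevOp.sq_inner_le_tsum_mul_dirichlet`, `RevOp.tauInt_le_of_forall_sq_inner_le_dirichlet_of_nonneg`)
and three facts about the SECTOR PROJECTION `P_χ v = N⁻¹ Σ_a χ(a)·(v ∘ t_a)`: it lands in the sector,
it is self-adjoint against sector elements (`⟨g, P_χ v⟩_w = ⟨g, v⟩_w`), and it never increases the
group-averaged Dirichlet form (`N`-point Cauchy–Schwarz + `𝓔_q̄(v ∘ t_a) = 𝓔_q̄(v)`).  Peskun 1973 /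
Tierney 1998 NAMED for the shape; the construction `q̄` is Boyda et al. 2021 / Hackett et al. 2021
§4.2 (NAMED, empirical there); nothing is cited as a fact.

## What is proved (`w, q̃ > 0` measurable integrable, `∫ q̃ = 1`, `w ∘ t_a = w`; class
`A = {measurable, ∫ v² w < ∞}`)

* `sq_avg_sign_le` — `(N⁻¹ Σ_a χ(a) y_a)² ≤ N⁻¹ Σ_a y_a²` for `χ(a)² = 1`;
* `sectorProj_sqClass`, **`sectorProj_covariant`** (`P_χ v ∘ t_b = χ(b)·P_χ v`),
  **`inner_sectorProj_eq`** (`∫ g (P_χ v) w = ∫ g v w` for `g ∘ t_a = χ(a)·g`),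
  **`groupAvg_dirichlet_sectorProj_le`** (`𝓔_q̄(P_χ v) ≤ 𝓔_q̄(v)`);
* **`groupAvg_tauInt_le_of_covariant`** — THE COMPARISON: `g ∈ A`, `∫ g² w > 0`, `g ∘ t_a = χ(a)·g`
  for all `a`, the normalised autocorrelation series of `g` under `K_q̃` summable ⇒ under `K_q̄` it is
  summable and **`τ_int^{q̄}(g) ≤ τ_int^{q̃}(g)`**;
* **`groupAvg_tauInt_le_of_invariant`** — the same for every INVARIANT square-integrable `g`.

NOT CLAIMED: observables outside a symmetry sector (mixed representations; false in general already for
`Z₂`); strictness; any value for any network; cost accounting (`N` model-density evaluations per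
proposal unless the flow is equivariant, in which case `q̄ = q̃`); HMC / local arms.  Lattice instances
are drawn in the lattice files.
-/

namespace Summit.Ventures.LatticeQCDFlow.Exactness

open Real MeasureTheory Filter Finset Set Topology
open Summit.Ventures.LatticeQCDFlow.Scoring

/-- `N`-point Cauchy–Schwarz with signs: `(N⁻¹ Σ_a χ(a) y_a)² ≤ N⁻¹ Σ_a y_a²` when `χ(a)² = 1`. -/
theorem sq_avg_sign_le {G : Type*} [Fintype G] [Nonempty G] {χ : G → ℝ} (hχ2 : ∀ a, χ a ^ 2 = 1)
    (y : G → ℝ) :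
    ((∑ a, χ a * y a) / Fintype.card G) ^ 2 ≤ (∑ a, y a ^ 2) / Fintype.card G := by
  have hN : (0 : ℝ) < Fintype.card G := by exact_mod_cast Fintype.card_pos
  have hcs := Finset.sum_mul_sq_le_sq_mul_sq Finset.univ χ y
  have hχ : ∑ a, χ a ^ 2 = Fintype.card G := by
    simp only [hχ2, Finset.sum_const, Finset.card_univ, nsmul_eq_mul, mul_one]
  rw [hχ] at hcs
  rw [div_pow, div_le_div_iff₀ (pow_pos hN 2) hN]
  nlinarith [hcs, hN]

section General

variable {X : Type*} [MeasurableSpace X] {μ : Measure X} [SFinite μ] {w q : X → ℝ}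
  {G : Type*} [Fintype G] [Group G] {t : G → X ≃ᵐ X} {χ : G → ℝ}

/-! ## §1 The sector projection `P_χ v = N⁻¹ Σ_a χ(a)·(v ∘ t_a)` -/

omit [SFinite μ] [Group G] in
/-- `P_χ v ∈ A` for `v ∈ A` (pointwise `(P_χ v)² w ≤ N⁻¹ Σ_a (v ∘ t_a)² w`). -/
theorem sectorProj_sqClass [Nonempty G] (ht : ∀ a, MeasurePreserving (t a) μ μ) (hw0 : ∀ x, 0 < w x)
    (hwm : Measurable w) (hw : ∀ a x, w (t a x) = w x) (hχ2 : ∀ a, χ a ^ 2 = 1) {v : X → ℝ}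
    (hvm : Measurable v) (hv2 : Integrable (fun x => v x ^ 2 * w x) μ) :
    Measurable (fun x => (∑ a, χ a * v (t a x)) / Fintype.card G) ∧
    Integrable (fun x => ((∑ a, χ a * v (t a x)) / Fintype.card G) ^ 2 * w x) μ := by
  have hva : ∀ a, Integrable (fun x => v (t a x) ^ 2 * w x) μ := fun a =>
    (sqClass_comp_symmetry ht hw a hvm hv2).2
  have hm : Measurable (fun x => (∑ a, χ a * v (t a x)) / Fintype.card G) :=
    (Finset.measurable_sum _ fun a _ => (hvm.comp (t a).measurable).const_mul _).div_const _
  refine ⟨hm, ?_⟩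
  have hdom : Integrable (fun x => (∑ a, v (t a x) ^ 2 * w x) / Fintype.card G) μ :=
    (integrable_finsetSum Finset.univ fun a _ => hva a).div_const _
  refine Integrable.mono' hdom ((hm.pow_const 2).mul hwm).aestronglyMeasurable
    (Eventually.of_forall fun x => ?_)
  rw [Real.norm_eq_abs, abs_of_nonneg (mul_nonneg (sq_nonneg _) (hw0 x).le)]
  have h := sq_avg_sign_le hχ2 (fun a => v (t a x))
  calc ((∑ a, χ a * v (t a x)) / Fintype.card G) ^ 2 * w x
      ≤ (∑ a, v (t a x) ^ 2) / Fintype.card G * w x := mul_le_mul_of_nonneg_right h (hw0 x).le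
    _ = (∑ a, v (t a x) ^ 2 * w x) / Fintype.card G := by rw [div_mul_eq_mul_div, Finset.sum_mul]

omit [MeasurableSpace X] in
/-- **The projection lands in the sector**: `(P_χ v)(t_b x) = χ(b)·(P_χ v)(x)` (group law,
`χ(ab) = χ(a)χ(b)`, `χ(b)² = 1`; reindex `a ↦ a b`). -/
theorem sectorProj_covariant {t : G → X → X} (hmul : ∀ a b x, t (a * b) x = t a (t b x))
    (hχ : ∀ a b, χ (a * b) = χ a * χ b) (hχ2 : ∀ a, χ a ^ 2 = 1) (v : X → ℝ) (b : G) (x : X) :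
    (∑ a, χ a * v (t a (t b x))) / Fintype.card G = χ b * ((∑ a, χ a * v (t a x)) / Fintype.card G) := by
  have key : χ b * ∑ a, χ a * v (t a (t b x)) = ∑ c, χ c * v (t c x) := by
    rw [Finset.mul_sum]
    have e : ∀ a, χ b * (χ a * v (t a (t b x))) = χ (a * b) * v (t (a * b) x) := fun a => by
      rw [hχ, hmul]; ring
    simp only [e]
    exact Fintype.sum_equiv (Equiv.mulRight b) (fun a => χ (a * b) * v (t (a * b) x))
      (fun c => χ c * v (t c x)) fun a => rfl
  have hb : χ b * χ b = 1 := by rw [← sq]; exact hχ2 b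
  calc (∑ a, χ a * v (t a (t b x))) / Fintype.card G
      = χ b * χ b * (∑ a, χ a * v (t a (t b x))) / Fintype.card G := by rw [hb, one_mul]
    _ = χ b * ((∑ c, χ c * v (t c x)) / Fintype.card G) := by rw [← key]; ring

omit [SFinite μ] [Group G] in
/-- **`⟨g, P_χ v⟩_w = ⟨g, v⟩_w` for every `g` in the sector** (`g ∘ t_a = χ(a)·g`): term by term
`∫ g·χ(a)(v∘t_a)·w = χ(a)² ∫ (g v w)∘t_a = ∫ g v w`. -/
theorem inner_sectorProj_eq [Nonempty G] (ht : ∀ a, MeasurePreserving (t a) μ μ)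
    (hw0 : ∀ x, 0 < w x) (hwm : Measurable w) (hw : ∀ a x, w (t a x) = w x) {g v : X → ℝ}
    (hgm : Measurable g) (hg2 : Integrable (fun x => g x ^ 2 * w x) μ) (hvm : Measurable v)
    (hv2 : Integrable (fun x => v x ^ 2 * w x) μ) (hχ2 : ∀ a, χ a ^ 2 = 1)
    (hg : ∀ a x, g (t a x) = χ a * g x) :
    ∫ x, g x * ((∑ a, χ a * v (t a x)) / Fintype.card G) * w x ∂μ = ∫ x, g x * v x * w x ∂μ := by
  have hN : (0 : ℝ) < Fintype.card G := by exact_mod_cast Fintype.card_pos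
  have hIa : ∀ a, Integrable (fun x => g x * v (t a x) * w x) μ := fun a =>
    sqClass_int hw0 hwm ⟨hgm, hg2⟩ (sqClass_comp_symmetry ht hw a hvm hv2)
  -- each term equals `∫ g v w`
  have hterm : ∀ a, ∫ x, g x * (χ a * v (t a x)) * w x ∂μ = ∫ x, g x * v x * w x ∂μ := fun a => by
    have hshift : ∫ x, g (t a x) * v (t a x) * w (t a x) ∂μ = ∫ x, g x * v x * w x ∂μ :=
      integral_comp_symmetry ht a (fun x => g x * v x * w x)
    have ha : χ a * χ a = 1 := by rw [← sq]; exact hχ2 a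
    have e : ∀ x, g x * (χ a * v (t a x)) * w x = χ a * χ a * (g x * (χ a * v (t a x)) * w x) :=
      fun x => by rw [ha, one_mul]
    rw [integral_congr_ae (Eventually.of_forall e), ← hshift]
    refine integral_congr_ae (Eventually.of_forall fun x => ?_)
    show χ a * χ a * (g x * (χ a * v (t a x)) * w x) = g (t a x) * v (t a x) * w (t a x)
    rw [hg, hw]
    have e3 : χ a * χ a * (g x * (χ a * v (t a x)) * w x)
        = (χ a * χ a) * (χ a * g x * v (t a x) * w x) := by ring
    rw [e3, ha, one_mul]
  have e : ∀ x, g x * ((∑ a, χ a * v (t a x)) / Fintype.card G) * w x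
      = (∑ a, g x * (χ a * v (t a x)) * w x) / Fintype.card G := fun x => by
    rw [← Finset.sum_mul, ← Finset.mul_sum]
    ring
  have hIa' : ∀ a, Integrable (fun x => g x * (χ a * v (t a x)) * w x) μ := fun a =>
    ((hIa a).const_mul (χ a)).congr (Eventually.of_forall fun x => by ring)
  rw [integral_congr_ae (Eventually.of_forall e), integral_div,
    integral_finsetSum Finset.univ fun a _ => hIa' a]
  simp only [hterm, Finset.sum_const, Finset.card_univ, nsmul_eq_mul]
  field_simp

/-- **`𝓔_q̄(P_χ v) ≤ 𝓔_q̄(v)`** for every `v ∈ A` (pointwise `N`-point Cauchy–Schwarz under the Dirichlet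
representation, then `𝓔_q̄(v ∘ t_a) = 𝓔_q̄(v)` along the group). -/
theorem groupAvg_dirichlet_sectorProj_le [Nonempty G] (ht : ∀ a, MeasurePreserving (t a) μ μ)
    (hmul : ∀ a b x, t (a * b) x = t a (t b x)) (hw0 : ∀ x, 0 < w x) (hwm : Measurable w)
    (hwi : Integrable w μ) (hw : ∀ a x, w (t a x) = w x) (hq0 : ∀ x, 0 < q x) (hqm : Measurable q)
    (hqi : Integrable q μ) (hq1 : ∫ z, q z ∂μ = 1) (hχ2 : ∀ a, χ a ^ 2 = 1) {v : X → ℝ}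
    (hvm : Measurable v) (hv2 : Integrable (fun x => v x ^ 2 * w x) μ) :
    (∫ x, ((∑ a, χ a * v (t a x)) / Fintype.card G) ^ 2 * w x ∂μ)
        - ∫ x, ((∑ a, χ a * v (t a x)) / Fintype.card G)
            * imhOp μ w (fun s => (∑ a, q (t a s)) / Fintype.card G)
                (fun y => (∑ a, χ a * v (t a y)) / Fintype.card G) x * w x ∂μ
      ≤ (∫ x, v x ^ 2 * w x ∂μ)
        - ∫ x, v x * imhOp μ w (fun s => (∑ a, q (t a s)) / Fintype.card G) v x * w x ∂μ := by
  have hN : (0 : ℝ) < Fintype.card G := by exact_mod_cast Fintype.card_pos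
  obtain ⟨hs0, hsm, hsi, hs1⟩ := groupAvg_facts ht hq0 hqm hqi hq1
  obtain ⟨hPm, hP2⟩ := sectorProj_sqClass ht hw0 hwm hw hχ2 hvm hv2
  have hvb : ∀ b, Measurable (fun x => v (t b x)) ∧ Integrable (fun x => v (t b x) ^ 2 * w x) μ :=
    fun b => sqClass_comp_symmetry ht hw b hvm hv2
  -- `𝓔_q̄(v ∘ t_b) = 𝓔_q̄(v)`, in the `½∫∫` representation
  have hEb : ∀ b, ∫ p, imhFlow w (fun s => (∑ a, q (t a s)) / Fintype.card G) p.1 p.2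
      * (v (t b p.1) - v (t b p.2)) ^ 2 ∂(μ.prod μ)
      = ∫ p, imhFlow w (fun s => (∑ a, q (t a s)) / Fintype.card G) p.1 p.2
        * (v p.1 - v p.2) ^ 2 ∂(μ.prod μ) := fun b => by
    have h := groupAvg_dirichlet_comp_symmetry ht hmul hw0 hwm hwi hw hq0 hqm hqi hq1 b hvm hv2
    rw [dirichlet_eq_half_sq_of_sq hw0 hwm hwi hs0 hsm hsi hs1 (hvb b).1 (hvb b).2,
      dirichlet_eq_half_sq_of_sq hw0 hwm hwi hs0 hsm hsi hs1 hvm hv2] at h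
    linarith
  rw [dirichlet_eq_half_sq_of_sq hw0 hwm hwi hs0 hsm hsi hs1 hPm hP2,
    dirichlet_eq_half_sq_of_sq hw0 hwm hwi hs0 hsm hsi hs1 hvm hv2]
  refine mul_le_mul_of_nonneg_left ?_ (by norm_num)
  have hIP := integrable_imhFlow_mul_sq_sub hw0 hwm hs0 hsm hsi hPm hP2
  have hIb : ∀ b, Integrable (fun p : X × X =>
      imhFlow w (fun s => (∑ a, q (t a s)) / Fintype.card G) p.1 p.2
        * (v (t b p.1) - v (t b p.2)) ^ 2) (μ.prod μ) := fun b =>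
    integrable_imhFlow_mul_sq_sub hw0 hwm hs0 hsm hsi (hvb b).1 (hvb b).2
  have hpt : ∀ p : X × X, imhFlow w (fun s => (∑ a, q (t a s)) / Fintype.card G) p.1 p.2
      * ((∑ a, χ a * v (t a p.1)) / Fintype.card G - (∑ a, χ a * v (t a p.2)) / Fintype.card G) ^ 2
        ≤ (∑ b, imhFlow w (fun s => (∑ a, q (t a s)) / Fintype.card G) p.1 p.2
          * (v (t b p.1) - v (t b p.2)) ^ 2) / Fintype.card G := fun p => by
    have hs := (imhFlow_nonneg_le hw0 hs0 p.1 p.2).1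
    have e : (∑ a, χ a * v (t a p.1)) / Fintype.card G - (∑ a, χ a * v (t a p.2)) / Fintype.card G
        = (∑ a, χ a * (v (t a p.1) - v (t a p.2))) / Fintype.card G := by
      rw [← sub_div, ← Finset.sum_sub_distrib]
      congr 1
      refine Finset.sum_congr rfl fun a _ => ?_
      ring
    rw [e, ← Finset.mul_sum, mul_div_assoc]
    exact mul_le_mul_of_nonneg_left (sq_avg_sign_le hχ2 fun a => v (t a p.1) - v (t a p.2)) hs
  calc ∫ p, imhFlow w (fun s => (∑ a, q (t a s)) / Fintype.card G) p.1 p.2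
        * ((∑ a, χ a * v (t a p.1)) / Fintype.card G - (∑ a, χ a * v (t a p.2)) / Fintype.card G) ^ 2
        ∂(μ.prod μ)
      ≤ ∫ p, (∑ b, imhFlow w (fun s => (∑ a, q (t a s)) / Fintype.card G) p.1 p.2
          * (v (t b p.1) - v (t b p.2)) ^ 2) / Fintype.card G ∂(μ.prod μ) :=
        integral_mono hIP ((integrable_finsetSum Finset.univ fun b _ => hIb b).div_const _) hpt
    _ = ∫ p, imhFlow w (fun s => (∑ a, q (t a s)) / Fintype.card G) p.1 p.2 * (v p.1 - v p.2) ^ 2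
          ∂(μ.prod μ) := by
        rw [integral_div, integral_finsetSum Finset.univ fun b _ => hIb b]
        simp only [hEb, Finset.sum_const, Finset.card_univ, nsmul_eq_mul]
        field_simp

/-! ## §2 The comparison theorem -/

/-- **AVERAGING A FLOW OVER A FINITE SYMMETRY GROUP NEVER INCREASES `τ_int` OF AN OBSERVABLE IN A
SYMMETRY SECTOR.**  `G` a finite group acting by measure-preserving `t_a` with `t_{ab} = t_a ∘ t_b` and
`w ∘ t_a = w`; `χ` a real sign character (`χ(ab) = χ(a)χ(b)`, `χ(a)² = 1`); `w, q̃ > 0` measurable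
integrable, `∫ q̃ = 1`; `g` measurable, `∫ g² w < ∞`, `∫ g² w > 0`, `g ∘ t_a = χ(a)·g` for all `a`.
If the normalised autocorrelation series of `g` under the flow sampler `imhOp μ w q̃` is summable, then
under the group-averaged sampler `imhOp μ w q̄` it is summable and `τ_int^{q̄}(g) ≤ τ_int^{q̃}(g)`. -/
theorem groupAvg_tauInt_le_of_covariant [Nonempty G] (ht : ∀ a, MeasurePreserving (t a) μ μ)
    (hmul : ∀ a b x, t (a * b) x = t a (t b x)) (hw0 : ∀ x, 0 < w x) (hwm : Measurable w)
    (hwi : Integrable w μ) (hw : ∀ a x, w (t a x) = w x) (hq0 : ∀ x, 0 < q x) (hqm : Measurable q)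
    (hqi : Integrable q μ) (hq1 : ∫ z, q z ∂μ = 1) (hχ : ∀ a b, χ (a * b) = χ a * χ b)
    (hχ2 : ∀ a, χ a ^ 2 = 1) {g : X → ℝ} (hgm : Measurable g)
    (hg2 : Integrable (fun x => g x ^ 2 * w x) μ) (hP : 0 < ∫ x, g x ^ 2 * w x ∂μ)
    (hg : ∀ a x, g (t a x) = χ a * g x)
    (hs : Summable fun n => (∫ x, g x * ((imhOp μ w q)^[n + 1] g) x * w x ∂μ)
      / ∫ x, g x ^ 2 * w x ∂μ) :
    (Summable fun n => (∫ x, g x * ((imhOp μ w (fun s => (∑ a, q (t a s)) / Fintype.card G))^[n + 1]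
        g) x * w x ∂μ) / ∫ x, g x ^ 2 * w x ∂μ) ∧
    tauInt (fun n => (∫ x, g x * ((imhOp μ w (fun s => (∑ a, q (t a s)) / Fintype.card G))^[n] g) x
        * w x ∂μ) / ∫ x, g x ^ 2 * w x ∂μ)
      ≤ tauInt (fun n => (∫ x, g x * ((imhOp μ w q)^[n] g) x * w x ∂μ) / ∫ x, g x ^ 2 * w x ∂μ) := by
  obtain ⟨hs0, hsm, hsi, hs1⟩ := groupAvg_facts ht hq0 hqm hqi hq1
  set P := ∫ x, g x ^ 2 * w x ∂μ with hPdef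
  set Cq : ℕ → ℝ := fun k => ∫ x, g x * ((imhOp μ w q)^[k] g) x * w x ∂μ with hCq
  set T := ∑' k, Cq k / P with hT
  have hposq : ∀ k, 0 ≤ Cq k := (acceptanceCeiling_setup_of_sq hw0 hwm hwi hq0 hqm hqi hq1 hgm hg2).2
  have hposs := (acceptanceCeiling_setup_of_sq hw0 hwm hwi hs0 hsm hsi hs1 hgm hg2).2
  have hT0 : 0 ≤ T := tsum_nonneg fun k => div_nonneg (hposq k) hP.le
  have hB : 0 ≤ P * T := mul_nonneg hP.le hT0
  -- the variational bound for the AVERAGED sampler with constant `P·T`, via the sector projection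
  have hvar : ∀ ⦃v : X → ℝ⦄, (Measurable v ∧ Integrable (fun x => v x ^ 2 * w x) μ) →
      (∫ x, g x * v x * w x ∂μ) ^ 2
        ≤ P * T * ((∫ x, v x ^ 2 * w x ∂μ)
          - ∫ x, v x * imhOp μ w (fun s => (∑ a, q (t a s)) / Fintype.card G) v x * w x ∂μ) := by
    intro v hv
    have hpc := sectorProj_sqClass ht hw0 hwm hw hχ2 hv.1 hv.2
    have hcov : ∀ b x, (fun x => (∑ a, χ a * v (t a x)) / Fintype.card G) (t b x)
        = χ b * (fun x => (∑ a, χ a * v (t a x)) / Fintype.card G) x := fun b x =>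
      sectorProj_covariant (t := fun a => (t a : X → X)) hmul hχ hχ2 v b x
    have h1 := inner_sectorProj_eq ht hw0 hwm hw hgm hg2 hv.1 hv.2 hχ2 hg
    have h2 := RevOp.sq_inner_le_tsum_mul_dirichlet (A := fun f : X → ℝ =>
        Measurable f ∧ Integrable (fun x => f x ^ 2 * w x) μ) (K := imhOp μ w q)
      (fun x => (hw0 x).le) (sqClass_int hw0 hwm) (sqClass_comb hw0 hwm)
      (sqClass_stab hw0 hwm hwi hq0 hqm hqi hq1) (sqClass_lin hw0 hwm hwi hq0 hqm hqi)
      (sqClass_symm hw0 hwm hwi hq0 hqm hqi hq1) (sqClass_contr hw0 hwm hwi hq0 hqm hqi hq1)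
      ⟨hgm, hg2⟩ hpc hs
    have h3 := groupAvg_dirichlet_ge_of_covariant ht hw0 hwm hwi hw hq0 hqm hqi hq1 hpc.1 hpc.2
      hχ2 hcov
    have h4 := groupAvg_dirichlet_sectorProj_le ht hmul hw0 hwm hwi hw hq0 hqm hqi hq1 hχ2 hv.1 hv.2
    rw [← h1]
    calc (∫ x, g x * ((∑ a, χ a * v (t a x)) / Fintype.card G) * w x ∂μ) ^ 2
        ≤ P * (T * ((∫ x, ((∑ a, χ a * v (t a x)) / Fintype.card G) ^ 2 * w x ∂μ)
            - ∫ x, ((∑ a, χ a * v (t a x)) / Fintype.card G)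
                * imhOp μ w q (fun y => (∑ a, χ a * v (t a y)) / Fintype.card G) x * w x ∂μ)) := h2
      _ ≤ P * (T * ((∫ x, ((∑ a, χ a * v (t a x)) / Fintype.card G) ^ 2 * w x ∂μ)
            - ∫ x, ((∑ a, χ a * v (t a x)) / Fintype.card G)
                * imhOp μ w (fun s => (∑ a, q (t a s)) / Fintype.card G)
                    (fun y => (∑ a, χ a * v (t a y)) / Fintype.card G) x * w x ∂μ)) :=
          mul_le_mul_of_nonneg_left (mul_le_mul_of_nonneg_left h3 hT0) hP.le
      _ ≤ P * (T * ((∫ x, v x ^ 2 * w x ∂μ)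
            - ∫ x, v x * imhOp μ w (fun s => (∑ a, q (t a s)) / Fintype.card G) v x * w x ∂μ)) :=
          mul_le_mul_of_nonneg_left (mul_le_mul_of_nonneg_left h4 hT0) hP.le
      _ = P * T * ((∫ x, v x ^ 2 * w x ∂μ)
            - ∫ x, v x * imhOp μ w (fun s => (∑ a, q (t a s)) / Fintype.card G) v x * w x ∂μ) := by
          ring
  obtain ⟨hsum, hτ⟩ := RevOp.tauInt_le_of_forall_sq_inner_le_dirichlet_of_nonneg
    (A := fun f : X → ℝ => Measurable f ∧ Integrable (fun x => f x ^ 2 * w x) μ)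
    (K := imhOp μ w (fun s => (∑ a, q (t a s)) / Fintype.card G)) (sqClass_int hw0 hwm)
    (sqClass_comb hw0 hwm) (sqClass_stab hw0 hwm hwi hs0 hsm hsi hs1)
    (sqClass_lin hw0 hwm hwi hs0 hsm hsi) (sqClass_symm hw0 hwm hwi hs0 hsm hsi hs1) ⟨hgm, hg2⟩ hP
    hposs hB hvar
  refine ⟨hsum, hτ.trans (le_of_eq ?_)⟩
  have hsum0 : Summable fun k => Cq k / P := (summable_nat_add_iff 1).1 hs
  have hC0 : Cq 0 / P = 1 := by
    have e : Cq 0 = P := by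
      simp only [hCq, hPdef, Function.iterate_zero, id_eq]
      exact integral_congr_ae (Eventually.of_forall fun x => by ring)
    rw [e, div_self hP.ne']
  have hTeq : T = 1 + ∑' k, Cq (k + 1) / P := by rw [hT, hsum0.tsum_eq_zero_add, hC0]
  show P * T / P - 1 / 2 = tauInt (fun n => Cq n / P)
  rw [mul_div_cancel_left₀ T hP.ne', hTeq]
  unfold tauInt
  ring

/-- **INVARIANT OBSERVABLES**: for every square-integrable `g` with `g ∘ t_a = g` for all `a` and
`∫ g² w > 0`, a summable series under the flow sampler stays summable under the group-averaged sampler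
and `τ_int^{q̄}(g) ≤ τ_int^{q̃}(g)`. -/
theorem groupAvg_tauInt_le_of_invariant [Nonempty G] (ht : ∀ a, MeasurePreserving (t a) μ μ)
    (hmul : ∀ a b x, t (a * b) x = t a (t b x)) (hw0 : ∀ x, 0 < w x) (hwm : Measurable w)
    (hwi : Integrable w μ) (hw : ∀ a x, w (t a x) = w x) (hq0 : ∀ x, 0 < q x) (hqm : Measurable q)
    (hqi : Integrable q μ) (hq1 : ∫ z, q z ∂μ = 1) {g : X → ℝ} (hgm : Measurable g)
    (hg2 : Integrable (fun x => g x ^ 2 * w x) μ) (hP : 0 < ∫ x, g x ^ 2 * w x ∂μ)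
    (hg : ∀ a x, g (t a x) = g x)
    (hs : Summable fun n => (∫ x, g x * ((imhOp μ w q)^[n + 1] g) x * w x ∂μ)
      / ∫ x, g x ^ 2 * w x ∂μ) :
    (Summable fun n => (∫ x, g x * ((imhOp μ w (fun s => (∑ a, q (t a s)) / Fintype.card G))^[n + 1]
        g) x * w x ∂μ) / ∫ x, g x ^ 2 * w x ∂μ) ∧
    tauInt (fun n => (∫ x, g x * ((imhOp μ w (fun s => (∑ a, q (t a s)) / Fintype.card G))^[n] g) x
        * w x ∂μ) / ∫ x, g x ^ 2 * w x ∂μ)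
      ≤ tauInt (fun n => (∫ x, g x * ((imhOp μ w q)^[n] g) x * w x ∂μ) / ∫ x, g x ^ 2 * w x ∂μ) :=
  groupAvg_tauInt_le_of_covariant ht hmul hw0 hwm hwi hw hq0 hqm hqi hq1 (χ := fun _ => 1)
    (fun _ _ => (one_mul 1).symm) (fun _ => one_pow 2) hgm hg2 hP (fun a x => by rw [hg, one_mul]) hs

end General

end Summit.Ventures.LatticeQCDFlow.Exactness
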